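import Summits.BirchSwinnertonDyer.BirchSwinnertonDyer.Theorems.ThetaPartnerAtTwoSignedKatoUpToAtTwoLocalTwoRealTrace
import Summits.BirchSwinnertonDyer.BirchSwinnertonDyer.Theorems.ThetaPartnerAtTwoSignedKatoUpToAtTwoLocalTwoCyclotomicTower
import Summits.BirchSwinnertonDyer.Rank1Residual.Additive.KobayashiLayerSaturation
import Summits.BirchSwinnertonDyer.Rank1Residual.Additive.KobayashiLayerLogDescent
import HarnessLib

/-!
# Route `ThetaPartnerAtTwo` (TP2), crux K3 `SignedKatoDivisibilityUpToAtTwo` (item stmt-BirchSwinnertonDyer-20308),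
# line `colemanrat` v3 — THE LOCAL THEORY AT `p = 2`, file 11: the `Δ`-twisted trace relation of the `ℤ₂`-tower is EXACT
# (`Tr_{n/n−1} e_n + e_{n−2} = 2c_1`) and the bookkeeping of inverters `σ ζ = ζ⁻¹`

HONEST FRAMING (cell `bsd-wall`, lead `bsd-wall-tp2-p2x` g3): THEOREMS ONLY — no definition, no named fact, no
instance, no `sorry`; local formal-group theory over `ℚ₂(μ_{2^∞})`; nothing about any Selmer group is asserted;
closes no item; BSD is NOT proved by any of this.

## Why this file

Residue (b) of the port memo `Cruxes/SignedKatoDivisibilityUpToAtTwo/G2-PORT-AT-2.md` §8 and the point half of K4's registered stub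
`stub_plusHondaSystemTwo` (crux `SignedControlAtTwo`, line `eulerchar` v6; split agreed on the cell bus 2026-08-27T23:27:44Z):
Kobayashi's `±`-theory at `p = 2` lives on the `ℤ₂`-layers `ℚ_{2,n} = ℚ₂(ζ_{2^{n+2}})⁺`, whose points are the `Δ`-traces
`e_n = c_{n+2} + σ c_{n+2}` (`σ ζ = ζ⁻¹`) of the μ-tower points of files 2/6 (`Λ(c_m) = ℓ_m`). File 9 proved the trace relation
of the `e_n` MODULO `E(ℚ₂)` (`Tr_{n/n−1} e_n + e_{n−2} ∈ E(ℚ₂)`). Here the defect is identified EXACTLY: its logarithm is `−2p = −4`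
(§1, every prime), and at `p = 2` the point `2c_1` (`ℓ_1 = ζ_2 − 1 = −2`) has the same logarithm, so by injectivity of `Λ` up to
`2`-power torsion and Prop. 8.7 at `2` (file 5) **`Tr_{n/n−1} e_n + e_{n−2} = 2c_1`** on the nose (§2). §3 records the Galois
bookkeeping of inverters in `localPoints W ℚ_[p]` (two inverters of `ζ_{p^m}` agree on `Stab ζ_{p^m}`-fixed points; `P + σP` is fixed
by every inverter and by `Stab`). The companion file `…LocalTwoPlusPoints` builds from this the renormalised points
`d_n = 3e_n − 2c_1` with `Tr d_n = −d_{n−2}` EXACTLY and `d_0 ∉ 2E(ℚ₂)`.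

## What is proved (`M/ℤ_p` with elliptic generic fibre; `Ω = ℚ̄_p`, `L(m)` = points with coordinates in `ℚ_p(ζ_{p^m})`,
## `E₁` = kernel of reduction, `Λ = ptLogΩ`, `ℓ_m = ell p m`)

* §1 (every prime) `ptLogΩ_sum_act_add_sum_act_add`: `Λ((∑_q act q̃ c) + (∑_q act q̃ (act σ c)) + (c' + act σ c')) = −2p`.
* §2 (`p = 2`, `2 ∣ a₁`, both fibres elliptic) `ell_two_one` (`ℓ_1 = −2`), `eq_zero_of_ptLogΩ_eq_zero_two`, `eq_of_ptLogΩ_eq_two`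
  (`Λ` is INJECTIVE on `L(m) ∩ E₁`), `sum_act_add_sum_act_add_eq_two_nsmul` (the exact relation `… = 2 • c₁`).
* §3 (every prime, `localPoints W ℚ_[p]`) `smul_zeta_eq_inv_of_le`, `mul_self_mem_stab_of_smul_zeta_eq_inv`,
  `inv_mul_mem_stab_of_smul_zeta_eq_inv`, `smul_eq_smul_of_smul_zeta_eq_inv`, `smul_add_smul_eq_of_smul_zeta_eq_inv`,
  `smul_add_smul_eq_of_mem_stab`.
* §4 (`p = 2`) `card_stab_quot_two` (`[Stab ζ_{2^m} : Stab ζ_{2^{m+1}}] = 2`, `m ≥ 1`), `sum_out_smul_eq_two_nsmul`, `stab_two_one`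
  (`Stab ζ_2 = Γ`), `ell_two_two_add_smul` (`ℓ_2 + σℓ_2 = −2`, the logarithm of `e_0`).

References: [Kobayashi2003] §8.4, Prop. 8.7, Lemma 8.9; [KuriharaOtsuki2006] §1.3, Prop. 1.4, p. 557; [Sprung2012] Thm. 2.2 (2′)
(p. 1487); [SilvermanAEC2009] IV.6.4.
-/

set_option autoImplicit false
-- the Theorems namespace of this sub repeats the summit name by design (D-0017 nested layout)
set_option linter.dupNamespace false

noncomputable section

open scoped Classical Topology NNReal
open Filter PowerSeries Finset

namespace Summit.BirchSwinnertonDyer.BirchSwinnertonDyer.Theorems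

namespace SignedKatoOffTwo.LocalTwo

open Literature.RingTheory.FormalGroups WeierstrassCurve Field
open Summit.BirchSwinnertonDyer.Rank1Residual.Additive
open Summit.BirchSwinnertonDyer.Rank1Residual.Additive.PadicCyclotomicTower
open Summit.BirchSwinnertonDyer.Rank1Residual.Additive.BallEval
open Summit.BirchSwinnertonDyer.BirchSwinnertonDyer.Theorems.SignedKatoOffTwo.LocalAllPrimes
open Literature.NumberTheory.EllipticCurves Literature.NumberTheory.EllipticCurves.FormalGroupChart
open Literature.NumberTheory.GaloisRepresentations
open Literature.NumberTheory.EllipticCurves.Rank1Residual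

/-! ## §1 The value of the logarithm in the `Δ`-twisted trace relation (every prime) -/

section Value

variable {p : ℕ} [hp : Fact p.Prime] {M : WeierstrassCurve ℤ_[p]}
  [hE : (M.map PadicInt.Coe.ringHom).IsElliptic]
  [hintΩ : (genFibΩ p M).IsIntegral (Valued.v (R := PadicAlgCl p)).integer]

/-- **The logarithm of file 9's `Δ`-twisted trace relation has the VALUE `−2p`**: for `m ≥ 1`, ANY `σ ∈ Gal(ℚ̄_p/ℚ_p)`,
tower points `c ∈ L(m+1) ∩ E₁`, `c' ∈ L(m−1) ∩ E₁` with `Λ(c) = ℓ_{m+1}`, `Λ(c') = ℓ_{m−1}`: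
`Λ((∑_q act q̃ c) + (∑_q act q̃ (act σ c)) + (c' + act σ c')) = −2p` (the twisted trace identity
`∑ q̃•(ℓ_{m+1} + σ•ℓ_{m+1}) = −2p − (ℓ_{m−1} + σ•ℓ_{m−1})` of file 9, §2). [cite: Kobayashi2003, Lemma 8.9]
[cite: KuriharaOtsuki2006, Prop. 1.4] -/
theorem ptLogΩ_sum_act_add_sum_act_add
    (act : Field.absoluteGaloisGroup ℚ_[p] → (genFibΩ p M).toAffine.Point → (genFibΩ p M).toAffine.Point)
    (hact0 : ∀ σ, act σ 0 = 0)
    (hact : ∀ σ (x y : PadicAlgCl p) (h : (genFibΩ p M).toAffine.Nonsingular x y),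
      ∃ h', act σ (Affine.Point.some x y h) = Affine.Point.some (σ • x) (σ • y) h')
    (σ : Field.absoluteGaloisGroup ℚ_[p]) {m : ℕ} (hm : 1 ≤ m)
    [Fintype (stab p m ⧸ (stab p (m + 1)).subgroupOf (stab p m))]
    {c c' : (genFibΩ p M).toAffine.Point}
    (hcL : c ∈ subfieldPoints (genFibΩ p M) (layer p (m + 1)).toSubfield coeffs_mem_layer)
    (hck : c ∈ kernel (Valued.v (R := PadicAlgCl p)) (genFibΩ p M)) (hcℓ : ptLogΩ p M c = ell p (m + 1))
    (hc'L : c' ∈ subfieldPoints (genFibΩ p M) (layer p (m - 1)).toSubfield coeffs_mem_layer)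
    (hc'k : c' ∈ kernel (Valued.v (R := PadicAlgCl p)) (genFibΩ p M)) (hc'ℓ : ptLogΩ p M c' = ell p (m - 1)) :
    ptLogΩ p M ((∑ q : stab p m ⧸ (stab p (m + 1)).subgroupOf (stab p m),
        act ((q.out : stab p m) : Field.absoluteGaloisGroup ℚ_[p]) c) +
      (∑ q : stab p m ⧸ (stab p (m + 1)).subgroupOf (stab p m),
        act ((q.out : stab p m) : Field.absoluteGaloisGroup ℚ_[p]) (act σ c)) +
      (c' + act σ c')) = -(2 * (p : PadicAlgCl p)) := by
  haveI := isIntegral_curveK p (LayerField p (m + 1)) M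
  have hσcL : act σ c ∈ subfieldPoints (genFibΩ p M) (layer p (m + 1)).toSubfield coeffs_mem_layer :=
    act_mem_subfieldPoints act hact0 hact σ hcL
  have hσck : act σ c ∈ kernel (Valued.v (R := PadicAlgCl p)) (genFibΩ p M) := act_mem_kernel act hact0 hact σ hck
  have hc'L' : c' ∈ subfieldPoints (genFibΩ p M) (layer p (m + 1)).toSubfield coeffs_mem_layer :=
    subfieldPoints_layer_mono (by omega) hc'L
  have hσc'L : act σ c' ∈ subfieldPoints (genFibΩ p M) (layer p (m + 1)).toSubfield coeffs_mem_layer :=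
    act_mem_subfieldPoints act hact0 hact σ hc'L'
  have hσc'k : act σ c' ∈ kernel (Valued.v (R := PadicAlgCl p)) (genFibΩ p M) := act_mem_kernel act hact0 hact σ hc'k
  have hS1L : (∑ q : stab p m ⧸ (stab p (m + 1)).subgroupOf (stab p m),
      act ((q.out : stab p m) : Field.absoluteGaloisGroup ℚ_[p]) c) ∈
        subfieldPoints (genFibΩ p M) (layer p (m + 1)).toSubfield coeffs_mem_layer :=
    (subfieldPoints _ _ _).sum_mem fun q _ => act_mem_subfieldPoints act hact0 hact _ hcL
  have hS1k : (∑ q : stab p m ⧸ (stab p (m + 1)).subgroupOf (stab p m),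
      act ((q.out : stab p m) : Field.absoluteGaloisGroup ℚ_[p]) c) ∈ kernel (Valued.v (R := PadicAlgCl p)) (genFibΩ p M) :=
    (kernel (Valued.v (R := PadicAlgCl p)) (genFibΩ p M)).sum_mem fun q _ => act_mem_kernel act hact0 hact _ hck
  have hS2L : (∑ q : stab p m ⧸ (stab p (m + 1)).subgroupOf (stab p m),
      act ((q.out : stab p m) : Field.absoluteGaloisGroup ℚ_[p]) (act σ c)) ∈
        subfieldPoints (genFibΩ p M) (layer p (m + 1)).toSubfield coeffs_mem_layer :=
    (subfieldPoints _ _ _).sum_mem fun q _ => act_mem_subfieldPoints act hact0 hact _ hσcL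
  have hS2k : (∑ q : stab p m ⧸ (stab p (m + 1)).subgroupOf (stab p m),
      act ((q.out : stab p m) : Field.absoluteGaloisGroup ℚ_[p]) (act σ c)) ∈ kernel (Valued.v (R := PadicAlgCl p)) (genFibΩ p M) :=
    (kernel (Valued.v (R := PadicAlgCl p)) (genFibΩ p M)).sum_mem fun q _ => act_mem_kernel act hact0 hact _ hσck
  have hDL : c' + act σ c' ∈ subfieldPoints (genFibΩ p M) (layer p (m + 1)).toSubfield coeffs_mem_layer :=
    (subfieldPoints _ _ _).add_mem hc'L' hσc'L
  have hDk : c' + act σ c' ∈ kernel (Valued.v (R := PadicAlgCl p)) (genFibΩ p M) :=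
    (kernel (Valued.v (R := PadicAlgCl p)) (genFibΩ p M)).add_mem hc'k hσc'k
  rw [ptLogΩ_add (m := m + 1) ((subfieldPoints _ _ _).add_mem hS1L hS2L) hDL
      ((kernel (Valued.v (R := PadicAlgCl p)) (genFibΩ p M)).add_mem hS1k hS2k) hDk,
    ptLogΩ_add (m := m + 1) hS1L hS2L hS1k hS2k,
    ptLogΩ_add (m := m + 1) hc'L' hσc'L hc'k hσc'k,
    ptLogΩ_finset_sum (m := m + 1) _ _ (fun q _ => act_mem_subfieldPoints act hact0 hact _ hcL)
      (fun q _ => act_mem_kernel act hact0 hact _ hck),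
    ptLogΩ_finset_sum (m := m + 1) _ _ (fun q _ => act_mem_subfieldPoints act hact0 hact _ hσcL)
      (fun q _ => act_mem_kernel act hact0 hact _ hσck)]
  simp_rw [ptLogΩ_act act hact0 hact _ (norm_zCoord_lt_one_of_mem_kernel hck),
    ptLogΩ_act act hact0 hact _ (norm_zCoord_lt_one_of_mem_kernel hσck),
    ptLogΩ_act act hact0 hact σ (norm_zCoord_lt_one_of_mem_kernel hck),
    ptLogΩ_act act hact0 hact σ (norm_zCoord_lt_one_of_mem_kernel hc'k), hcℓ, hc'ℓ]
  rw [← sum_add_distrib]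
  simp_rw [← smul_add]
  rw [sum_smul_add_smul_ell_succ p hm σ]
  ring

end Value

/-! ## §2 The `Δ`-twisted trace relation at `p = 2` is EXACT: the defect is `2c_1` -/

section Exact

variable {M : WeierstrassCurve ℤ_[2]}
  [hE : (M.map PadicInt.Coe.ringHom).IsElliptic] [hEt : (M.map PadicInt.toZMod).IsElliptic]
  [hintΩ : (genFibΩ 2 M).IsIntegral (Valued.v (R := PadicAlgCl 2)).integer]

/-- `ℓ_1 = ζ_2 − 1 = −2` at `p = 2`. [folklore] -/
theorem ell_two_one : ell 2 1 = -2 := by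
  rw [ell, sum_range_one, pow_zero, one_mul, mul_zero, Nat.sub_zero, pow_zero, div_one]
  have hz : zeta 2 1 = -1 := by
    have h := isPrimitiveRoot_zeta 2 1
    rw [pow_one] at h
    exact h.eq_neg_one_of_two_right
  rw [hz]; norm_num

/-- **A point of `L(m) ∩ E₁` with logarithm `0` is `O`** at `p = 2` on a good supersingular model with `2 ∣ a₁`
(injectivity of `Λ` up to `2`-power torsion + Prop. 8.7 at `2`, file 5). [cite: Kobayashi2003, Prop. 8.7, §8.4] -/
theorem eq_zero_of_ptLogΩ_eq_zero_two (h₁ : M.a₁ ∈ IsLocalRing.maximalIdeal ℤ_[2]) {m : ℕ}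
    {Q : (genFibΩ 2 M).toAffine.Point}
    (hQ : Q ∈ subfieldPoints (genFibΩ 2 M) (layer 2 m).toSubfield coeffs_mem_layer)
    (hk : Q ∈ kernel (Valued.v (R := PadicAlgCl 2)) (genFibΩ 2 M)) (h0 : ptLogΩ 2 M Q = 0) : Q = 0 := by
  haveI := isIntegral_curveK 2 (LayerField 2 m) M
  obtain ⟨k, hk0⟩ := exists_pow_smul_eq_zero_of_ptLogΩ_eq_zero (m := m) hQ hk h0
  exact eq_zero_of_two_pow_smul_eq_zero_of_mem_subfieldPoints_layer M h₁ m hQ hk0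

/-- **Two points of `L(m) ∩ E₁` with the same logarithm are EQUAL** (`p = 2`, good supersingular model, `2 ∣ a₁`).
[cite: Kobayashi2003, Prop. 8.7, §8.4] -/
theorem eq_of_ptLogΩ_eq_two (h₁ : M.a₁ ∈ IsLocalRing.maximalIdeal ℤ_[2]) {m : ℕ}
    {Q Q' : (genFibΩ 2 M).toAffine.Point}
    (hQ : Q ∈ subfieldPoints (genFibΩ 2 M) (layer 2 m).toSubfield coeffs_mem_layer)
    (hk : Q ∈ kernel (Valued.v (R := PadicAlgCl 2)) (genFibΩ 2 M))
    (hQ' : Q' ∈ subfieldPoints (genFibΩ 2 M) (layer 2 m).toSubfield coeffs_mem_layer)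
    (hk' : Q' ∈ kernel (Valued.v (R := PadicAlgCl 2)) (genFibΩ 2 M)) (h : ptLogΩ 2 M Q = ptLogΩ 2 M Q') : Q = Q' := by
  have hD : ptLogΩ 2 M (Q - Q') = 0 := by rw [ptLogΩ_sub (m := m) hQ hQ' hk hk', h, sub_self]
  exact sub_eq_zero.mp (eq_zero_of_ptLogΩ_eq_zero_two h₁ ((subfieldPoints _ _ _).sub_mem hQ hQ')
    ((kernel (Valued.v (R := PadicAlgCl 2)) (genFibΩ 2 M)).sub_mem hk hk') hD)

/-- **The EXACT `Δ`-twisted trace relation at `p = 2`.** On a good supersingular `ℤ₂`-model with `2 ∣ a₁`, for `m ≥ 1`,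
ANY `σ ∈ Gal(ℚ̄₂/ℚ₂)`, and tower points `c ∈ L(m+1) ∩ E₁`, `c' ∈ L(m−1) ∩ E₁`, `c₁ ∈ L(1) ∩ E₁` with `Λ(c) = ℓ_{m+1}`,
`Λ(c') = ℓ_{m−1}`, `Λ(c₁) = ℓ_1 = −2`:
`(∑_q act q̃ c) + (∑_q act q̃ (act σ c)) + (c' + act σ c') = 2 • c₁` — both sides lie in `L(m+1) ∩ E₁` and have
logarithm `−4` (§1, `ell_two_one`). With `σ ζ_{2^{m+1}} = ζ_{2^{m+1}}⁻¹` this reads `Tr_{n/n−1} e_n + e_{n−2} = 2c_1` for the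
`ℤ₂`-tower points `e_n = c_{n+2} + σc_{n+2}` (`n = m − 1`). [cite: Kobayashi2003, Lemma 8.9] [cite: KuriharaOtsuki2006, Prop. 1.4] -/
theorem sum_act_add_sum_act_add_eq_two_nsmul (h₁ : M.a₁ ∈ IsLocalRing.maximalIdeal ℤ_[2])
    (act : Field.absoluteGaloisGroup ℚ_[2] → (genFibΩ 2 M).toAffine.Point → (genFibΩ 2 M).toAffine.Point)
    (hact0 : ∀ σ, act σ 0 = 0)
    (hact : ∀ σ (x y : PadicAlgCl 2) (h : (genFibΩ 2 M).toAffine.Nonsingular x y),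
      ∃ h', act σ (Affine.Point.some x y h) = Affine.Point.some (σ • x) (σ • y) h')
    (σ : Field.absoluteGaloisGroup ℚ_[2]) {m : ℕ} (hm : 1 ≤ m)
    [Fintype (stab 2 m ⧸ (stab 2 (m + 1)).subgroupOf (stab 2 m))]
    {c c' c₁ : (genFibΩ 2 M).toAffine.Point}
    (hcL : c ∈ subfieldPoints (genFibΩ 2 M) (layer 2 (m + 1)).toSubfield coeffs_mem_layer)
    (hck : c ∈ kernel (Valued.v (R := PadicAlgCl 2)) (genFibΩ 2 M)) (hcℓ : ptLogΩ 2 M c = ell 2 (m + 1))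
    (hc'L : c' ∈ subfieldPoints (genFibΩ 2 M) (layer 2 (m - 1)).toSubfield coeffs_mem_layer)
    (hc'k : c' ∈ kernel (Valued.v (R := PadicAlgCl 2)) (genFibΩ 2 M)) (hc'ℓ : ptLogΩ 2 M c' = ell 2 (m - 1))
    (hc₁L : c₁ ∈ subfieldPoints (genFibΩ 2 M) (layer 2 1).toSubfield coeffs_mem_layer)
    (hc₁k : c₁ ∈ kernel (Valued.v (R := PadicAlgCl 2)) (genFibΩ 2 M)) (hc₁ℓ : ptLogΩ 2 M c₁ = ell 2 1) :
    (∑ q : stab 2 m ⧸ (stab 2 (m + 1)).subgroupOf (stab 2 m), act ((q.out : stab 2 m) : Field.absoluteGaloisGroup ℚ_[2]) c) +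
      (∑ q : stab 2 m ⧸ (stab 2 (m + 1)).subgroupOf (stab 2 m),
        act ((q.out : stab 2 m) : Field.absoluteGaloisGroup ℚ_[2]) (act σ c)) +
      (c' + act σ c') = 2 • c₁ := by
  have hσcL : act σ c ∈ subfieldPoints (genFibΩ 2 M) (layer 2 (m + 1)).toSubfield coeffs_mem_layer :=
    act_mem_subfieldPoints act hact0 hact σ hcL
  have hσck : act σ c ∈ kernel (Valued.v (R := PadicAlgCl 2)) (genFibΩ 2 M) := act_mem_kernel act hact0 hact σ hck
  have hc'L' : c' ∈ subfieldPoints (genFibΩ 2 M) (layer 2 (m + 1)).toSubfield coeffs_mem_layer :=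
    subfieldPoints_layer_mono (by omega) hc'L
  have hc₁L' : c₁ ∈ subfieldPoints (genFibΩ 2 M) (layer 2 (m + 1)).toSubfield coeffs_mem_layer :=
    subfieldPoints_layer_mono (by omega) hc₁L
  have hLHS_L : (∑ q : stab 2 m ⧸ (stab 2 (m + 1)).subgroupOf (stab 2 m),
      act ((q.out : stab 2 m) : Field.absoluteGaloisGroup ℚ_[2]) c) +
      (∑ q : stab 2 m ⧸ (stab 2 (m + 1)).subgroupOf (stab 2 m),
        act ((q.out : stab 2 m) : Field.absoluteGaloisGroup ℚ_[2]) (act σ c)) +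
      (c' + act σ c') ∈ subfieldPoints (genFibΩ 2 M) (layer 2 (m + 1)).toSubfield coeffs_mem_layer :=
    (subfieldPoints _ _ _).add_mem ((subfieldPoints _ _ _).add_mem
      ((subfieldPoints _ _ _).sum_mem fun q _ => act_mem_subfieldPoints act hact0 hact _ hcL)
      ((subfieldPoints _ _ _).sum_mem fun q _ => act_mem_subfieldPoints act hact0 hact _ hσcL))
      ((subfieldPoints _ _ _).add_mem hc'L' (act_mem_subfieldPoints act hact0 hact σ hc'L'))
  have hLHS_k : (∑ q : stab 2 m ⧸ (stab 2 (m + 1)).subgroupOf (stab 2 m),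
      act ((q.out : stab 2 m) : Field.absoluteGaloisGroup ℚ_[2]) c) +
      (∑ q : stab 2 m ⧸ (stab 2 (m + 1)).subgroupOf (stab 2 m),
        act ((q.out : stab 2 m) : Field.absoluteGaloisGroup ℚ_[2]) (act σ c)) +
      (c' + act σ c') ∈ kernel (Valued.v (R := PadicAlgCl 2)) (genFibΩ 2 M) :=
    (kernel (Valued.v (R := PadicAlgCl 2)) (genFibΩ 2 M)).add_mem ((kernel (Valued.v (R := PadicAlgCl 2)) (genFibΩ 2 M)).add_mem
      ((kernel (Valued.v (R := PadicAlgCl 2)) (genFibΩ 2 M)).sum_mem fun q _ => act_mem_kernel act hact0 hact _ hck)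
      ((kernel (Valued.v (R := PadicAlgCl 2)) (genFibΩ 2 M)).sum_mem fun q _ => act_mem_kernel act hact0 hact _ hσck))
      ((kernel (Valued.v (R := PadicAlgCl 2)) (genFibΩ 2 M)).add_mem hc'k (act_mem_kernel act hact0 hact σ hc'k))
  refine eq_of_ptLogΩ_eq_two h₁ (m := m + 1) hLHS_L hLHS_k ((subfieldPoints _ _ _).nsmul_mem hc₁L' 2)
    ((kernel (Valued.v (R := PadicAlgCl 2)) (genFibΩ 2 M)).nsmul_mem hc₁k 2) ?_
  rw [ptLogΩ_sum_act_add_sum_act_add act hact0 hact σ hm hcL hck hcℓ hc'L hc'k hc'ℓ,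
    ptLogΩ_nsmul (m := 1) hc₁L hc₁k 2, hc₁ℓ, ell_two_one]
  norm_num

end Exact

/-! ## §3 Galois bookkeeping in `localPoints W ℚ_[p]`: inverters of `ζ_{p^m}` (every prime) -/

section Inverters

variable {p : ℕ} [hp : Fact p.Prime] {K : Type} [Field K] [Algebra K ℚ_[p]] {W : WeierstrassCurve K}

/-- An inverter of `ζ_{p^{m+j}}` inverts `ζ_{p^m} = ζ_{p^{m+j}}^{p^j}`. [folklore] -/
theorem smul_zeta_eq_inv_of_le {m m' : ℕ} (h : m ≤ m') {σ : Field.absoluteGaloisGroup ℚ_[p]}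
    (hσ : σ • zeta p m' = (zeta p m')⁻¹) : σ • zeta p m = (zeta p m)⁻¹ := by
  obtain ⟨j, rfl⟩ := Nat.exists_eq_add_of_le h
  rw [← zeta_add_pow p m j, smul_pow', hσ, inv_pow]

/-- The square of an inverter of `ζ_{p^m}` stabilises `ζ_{p^m}`. [folklore] -/
theorem mul_self_mem_stab_of_smul_zeta_eq_inv {m : ℕ} {σ : Field.absoluteGaloisGroup ℚ_[p]}
    (hσ : σ • zeta p m = (zeta p m)⁻¹) : σ * σ ∈ stab p m := by
  rw [mem_stab_iff, mul_smul, hσ, Field.absoluteGaloisGroup.smul_def, map_inv₀,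
    ← Field.absoluteGaloisGroup.smul_def, hσ, inv_inv]

/-- Two inverters of `ζ_{p^m}` differ by an element of `Stab ζ_{p^m}`. [folklore] -/
theorem inv_mul_mem_stab_of_smul_zeta_eq_inv {m : ℕ} {σ σ' : Field.absoluteGaloisGroup ℚ_[p]}
    (hσ : σ • zeta p m = (zeta p m)⁻¹) (hσ' : σ' • zeta p m = (zeta p m)⁻¹) : σ⁻¹ * σ' ∈ stab p m := by
  rw [mem_stab_iff, mul_smul, hσ', ← hσ, inv_smul_smul]

/-- **Two inverters of `ζ_{p^m}` act in the same way on a point fixed by `Stab ζ_{p^m}`.** [folklore] -/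
theorem smul_eq_smul_of_smul_zeta_eq_inv {m : ℕ} {σ σ' : Field.absoluteGaloisGroup ℚ_[p]}
    (hσ : σ • zeta p m = (zeta p m)⁻¹) (hσ' : σ' • zeta p m = (zeta p m)⁻¹) {P : localPoints W ℚ_[p]}
    (hP : ∀ τ ∈ stab p m, τ • P = P) : σ' • P = σ • P := by
  have h := hP _ (inv_mul_mem_stab_of_smul_zeta_eq_inv hσ hσ')
  rw [mul_smul] at h
  calc σ' • P = σ • (σ⁻¹ • (σ' • P)) := (smul_inv_smul σ (σ' • P)).symm
    _ = σ • P := by rw [h]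

/-- A point of the form `P + σ • P` with `P` fixed by `Stab ζ_{p^m}` is fixed by every inverter `σ'` of `ζ_{p^m}`
(when `σ` is one): `σ' • P = σ • P` and `σ' • σ • P = P` (`σ'σ ∈ Stab`). [folklore] -/
theorem smul_add_smul_eq_of_smul_zeta_eq_inv {m : ℕ} {σ σ' : Field.absoluteGaloisGroup ℚ_[p]}
    (hσ : σ • zeta p m = (zeta p m)⁻¹) (hσ' : σ' • zeta p m = (zeta p m)⁻¹) {P : localPoints W ℚ_[p]}
    (hP : ∀ τ ∈ stab p m, τ • P = P) : σ' • (P + σ • P) = P + σ • P := by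
  have h1 : σ' • P = σ • P := smul_eq_smul_of_smul_zeta_eq_inv hσ hσ' hP
  have h2 : σ' * σ ∈ stab p m := by
    rw [mem_stab_iff, mul_smul, hσ, Field.absoluteGaloisGroup.smul_def, map_inv₀,
      ← Field.absoluteGaloisGroup.smul_def, hσ', inv_inv]
  rw [smul_add, ← mul_smul, hP _ h2, h1, add_comm]

/-- The stabilisers fix sums `P + σ • P` of points they fix (`Stab ζ_{p^m}` is normal). [folklore] -/
theorem smul_add_smul_eq_of_mem_stab {m : ℕ} (σ : Field.absoluteGaloisGroup ℚ_[p]) {τ : Field.absoluteGaloisGroup ℚ_[p]}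
    (hτ : τ ∈ stab p m) {P : localPoints W ℚ_[p]} (hP : ∀ τ ∈ stab p m, τ • P = P) :
    τ • (P + σ • P) = P + σ • P := by
  have hn : σ⁻¹ * τ * σ ∈ stab p m := by
    have := (normal_stab (p := p) m).conj_mem τ hτ σ⁻¹
    rwa [inv_inv] at this
  have h2 : τ • σ • P = σ • P := by
    have h := hP _ hn
    rw [mul_smul, mul_smul] at h
    calc τ • σ • P = σ • (σ⁻¹ • (τ • (σ • P))) := (smul_inv_smul σ _).symm
      _ = σ • P := by rw [h]
  rw [smul_add, hP τ hτ, h2]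

end Inverters

/-! ## §4 Small facts at `p = 2`: `[Stab ζ_{2^m} : Stab ζ_{2^{m+1}}] = 2`, `Stab ζ_2 = Γ`, `ℓ_2 + σℓ_2 = −2` -/

section TwoMisc

variable {K : Type} [Field K] [Algebra K ℚ_[2]] {W : WeierstrassCurve K}

/-- `[Stab ζ_{2^m} : Stab ζ_{2^{m+1}}] = 2` for `m ≥ 1` (`[ℚ₂(ζ_{2^{m+1}}) : ℚ₂(ζ_{2^m})] = 2`). [folklore] -/
theorem card_stab_quot_two {m : ℕ} (hm : 1 ≤ m) [Fintype (stab 2 m ⧸ (stab 2 (m + 1)).subgroupOf (stab 2 m))] :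
    Fintype.card (stab 2 m ⧸ (stab 2 (m + 1)).subgroupOf (stab 2 m)) = 2 := by
  rw [← Nat.card_eq_fintype_card, ← Subgroup.index, index_subgroupOf_stab_succ, if_neg (by omega)]

/-- A trace sum over `Stab ζ_{2^m}/Stab ζ_{2^{m+1}}` (`m ≥ 1`) of a point fixed by `Stab ζ_{2^m}` is twice the point. [folklore] -/
theorem sum_out_smul_eq_two_nsmul {m : ℕ} (hm : 1 ≤ m) [Fintype (stab 2 m ⧸ (stab 2 (m + 1)).subgroupOf (stab 2 m))]
    {P : localPoints W ℚ_[2]} (hP : ∀ τ ∈ stab 2 m, τ • P = P) :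
    ∑ q : stab 2 m ⧸ (stab 2 (m + 1)).subgroupOf (stab 2 m), ((q.out : stab 2 m) : Field.absoluteGaloisGroup ℚ_[2]) • P =
      2 • P := by
  rw [Finset.sum_congr rfl fun q _ => hP _ (q.out).2, Finset.sum_const, Finset.card_univ, card_stab_quot_two hm]

/-- `Stab ζ_2 = Γ` at `p = 2` (`ζ_2 = −1 ∈ ℚ₂`). [folklore] -/
theorem stab_two_one : stab 2 1 = ⊤ := by
  ext τ
  simp only [Subgroup.mem_top, iff_true, mem_stab_iff]
  have hz : zeta 2 1 = -1 := by
    have h := isPrimitiveRoot_zeta 2 1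
    rw [pow_one] at h
    exact h.eq_neg_one_of_two_right
  rw [hz, show (-1 : PadicAlgCl 2) = -((1 : ℕ) : PadicAlgCl 2) by norm_num, smul_neg, smul_natCast]

/-- `ℓ_2 + σ•ℓ_2 = −2` for an inverter `σ` of `ζ_4` (`ℓ_2 = ζ_4 − 1`, `ζ_4 + ζ_4⁻¹ = 0`): the logarithm of `e_0 = c_2 + σc_2`.
[cite: KuriharaOtsuki2006, §1.3] -/
theorem ell_two_two_add_smul {σ : Field.absoluteGaloisGroup ℚ_[2]} (hσ : σ • zeta 2 2 = (zeta 2 2)⁻¹) :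
    ell 2 2 + σ • ell 2 2 = -2 := by
  have hℓ : ell 2 2 = zeta 2 2 - 1 := by
    rw [ell, Finset.sum_range_succ, Finset.sum_range_one]
    simp only [pow_zero, one_mul, mul_zero, Nat.sub_zero, div_one, pow_one, mul_one]
    rw [show (2 - 2 : ℕ) = 0 from rfl, zeta_zero, sub_self, mul_zero, zero_div, add_zero]
  have hζ4 : IsPrimitiveRoot (zeta 2 2) (2 * 2) := by simpa using isPrimitiveRoot_zeta 2 2
  have hsq : zeta 2 2 ^ 2 = -1 := (hζ4.pow (by norm_num) rfl).eq_neg_one_of_two_right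
  have hinv : (zeta 2 2)⁻¹ = -zeta 2 2 := by
    refine inv_eq_of_mul_eq_one_right ?_
    linear_combination (-1 : PadicAlgCl 2) * hsq
  have h1 : σ • (1 : PadicAlgCl 2) = 1 := by rw [Field.absoluteGaloisGroup.smul_def, map_one]
  rw [hℓ, smul_sub, hσ, hinv, h1]
  ring

end TwoMisc


end SignedKatoOffTwo.LocalTwo

end Summit.BirchSwinnertonDyer.BirchSwinnertonDyer.Theorems

end
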